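import Mathlib
import Summits.ResolutionOfSingularities.ResolutionOfSingularities.Theorems.RisoStrataRisoCentresResolvePlumbing
import Literature.AlgebraicGeometry.Resolution.RegularLocusPerfectField

/-!
# Route RisoStrata — crux `RisoCentresResolve` (stmt-ResolutionOfSingularities-18546),
# line `Sketch`: stub `stub_rcrRegNbhd`
# (regularity at a centre spreads over a Zariski–Riemann neighbourhood)

For a finitely generated `k`-subalgebra `B ⊆ O` of the function field `K` (`k` algebraically
closed, hence perfect) whose local ring `risoLoc O B = B_{𝔪_O ∩ B}` at the centre of the valuation
ring `O` is regular, there is `f ∈ B` with `f⁻¹ ∈ O` such that `risoLoc O' B` is regular for every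
valuation ring `O' ⊇ B` containing `f⁻¹`: "regular at the centre" is an open condition on the
Zariski–Riemann space (basic opens `{O' | f⁻¹ ∈ O'}`).

Proof sketch.
* `A := ↥B.toSubring` is of finite type over the perfect field `k`, so its regular locus
  `Reg(A) ⊆ Spec A` is open (`isOpen_regularLocus_of_perfectField`, tree file
  `RegularLocusPerfectField.lean`).
* The centre `𝔭 = 𝔪_O ∩ B` (`subringCentre`) lies in `Reg(A)` by `hreg` and the plumbing bridge
  `isRegularLocalRing_risoLoc_iff`; the basis of basic opens gives `f : A` with `f ∉ 𝔭` and
  `D(f) ⊆ Reg(A)`.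
* `f ∉ 𝔭` means `ν_O(f) = 0`, so `f ≠ 0` and `f⁻¹ ∈ O`.
* If `B ⊆ O'` and `f⁻¹ ∈ O'`, then `f` is a unit of `O'`, so `f ∉ 𝔭' = 𝔪_{O'} ∩ B`, i.e.
  `𝔭' ∈ D(f) ⊆ Reg(A)`, and `isRegularLocalRing_risoLoc_iff` (backwards) finishes.

No definitions, no named facts.
-/

noncomputable section

set_option linter.dupNamespace false -- mandated namespace of this single-conjunct summit

namespace Summit.ResolutionOfSingularities.ResolutionOfSingularities.Theorems

open Literature.AlgebraicGeometry.Resolution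

/-- The regular locus of (the underlying subring of) a finitely generated `k`-subalgebra of `K`,
`k` perfect, is open in its prime spectrum. [folklore] -/
theorem regNbhd_isOpen_regularLocus {k K : Type} [Field k] [PerfectField k] [Field K]
    [Algebra k K] (B : Subalgebra k K) (hB : B.FG) : IsOpen (regularLocus ↥B.toSubring) := by
  letI : Algebra k ↥B.toSubring := B.algebra
  haveI : Algebra.FiniteType k ↥B.toSubring := (Subalgebra.fg_iff_finiteType B).mp hB
  exact isOpen_regularLocus_of_perfectField k ↥B.toSubring

/-- An element of `B ⊆ O'` whose inverse lies in `O'` is off the centre of `O'` on `B`.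
[folklore] -/
theorem regNbhd_not_mem_subringCentre {K : Type} [Field K] {O' : ValuationSubring K}
    {B : Subring K} (hBO' : B ≤ O'.toSubring) {f : ↥B} (hf0 : (f : K) ≠ 0)
    (hf : (f : K)⁻¹ ∈ O') : f ∉ subringCentre B O' hBO' := by
  rw [mem_subringCentre_iff, valuation_eq_one_of_mem_of_inv_mem (hBO' f.2) hf hf0]
  exact lt_irrefl 1

/-- **Regularity at the centre of a valuation ring spreads over a Zariski–Riemann neighbourhood.**
For a finitely generated `k`-subalgebra `B ⊆ O` of `K` (`k` algebraically closed) with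
`risoLoc O B` regular, some `f ∈ B` with `f⁻¹ ∈ O` has `risoLoc O' B` regular for every valuation
ring `O' ⊇ B` containing `f⁻¹` (openness of the regular locus of a finitely generated algebra over
a perfect field). [folklore] -/
theorem stub_rcrRegNbhd {k K : Type} [Field k] [IsAlgClosed k] [Field K] [Algebra k K]
    (O : ValuationSubring K) (B : Subalgebra k K) (hB : B.FG) (hBO : B.toSubring ≤ O.toSubring)
    (hreg : IsRegularLocalRing ↥(risoLoc O B)) :
    ∃ f : K, f ∈ B ∧ f⁻¹ ∈ O ∧ ∀ O' : ValuationSubring K, B.toSubring ≤ O'.toSubring →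
      f⁻¹ ∈ O' → IsRegularLocalRing ↥(risoLoc O' B) := by
  -- the centre of `O` on `B` is a regular point of `Spec B`
  have h𝔭 : (⟨subringCentre B.toSubring O hBO, inferInstance⟩ : PrimeSpectrum ↥B.toSubring) ∈
      regularLocus ↥B.toSubring :=
    (mem_regularLocus _).mpr ((isRegularLocalRing_risoLoc_iff hBO).mp hreg)
  -- a basic open neighbourhood `D(f) ⊆ Reg(B)` of the centre
  obtain ⟨_, ⟨f, rfl⟩, hf𝔭, hfreg⟩ :=
    PrimeSpectrum.isTopologicalBasis_basic_opens.exists_subset_of_mem_open h𝔭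
      (regNbhd_isOpen_regularLocus B hB)
  have hf𝔭' : f ∉ subringCentre B.toSubring O hBO := hf𝔭
  have hv : O.valuation (f : K) = 1 := valuation_eq_one_of_not_mem_subringCentre hBO hf𝔭'
  have hf0 : (f : K) ≠ 0 := ne_zero_of_valuation_eq_one hv
  refine ⟨(f : K), f.2, ?_, fun O' hBO' hfO' => ?_⟩
  · rw [← O.valuation_le_one_iff, map_inv₀, hv, inv_one]
  · have hmem : (⟨subringCentre B.toSubring O' hBO', inferInstance⟩ : PrimeSpectrum ↥B.toSubring) ∈
        (PrimeSpectrum.basicOpen f : Set (PrimeSpectrum ↥B.toSubring)) :=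
      regNbhd_not_mem_subringCentre hBO' hf0 hfO'
    exact (isRegularLocalRing_risoLoc_iff hBO').mpr ((mem_regularLocus _).mp (hfreg hmem))

end Summit.ResolutionOfSingularities.ResolutionOfSingularities.Theorems

end
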